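/-
Copyright (c) 2026. All rights reserved.
Released under Apache 2.0 license as described in the file LICENSE.
Authors: abc-iut cell — prover seat abc-iut-L4-d2 (gen 7).
-/
import Mathlib.Algebra.Field.ULift
import Mathlib.Algebra.Ring.ULift
import Mathlib.Data.Complex.Basic
import Literature.AnabelianGeometry.AbsoluteAnabelian.TPairsCor52Conditional
import HarnessLib

/-!
# [AbsTopIII] Cor 5.2 (iii): the archimedean rigidity law (X) of `TPairsCor52Conditional` is REFUTABLE;
# non-vacuous conditional closers for `ReferencePairIsoUnique` / `TPairHomDeterminedByTheaterHom`

S. Mochizuki, *Topics in absolute anabelian geometry III: global reconstruction algorithms*, J. Math. Sci. Univ.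
Tokyo 22 (2015) 939–1156 [MochizukiAbsTopIII2015]; manuscript pages (cell render `AbsTopIII-kurims-url-5493eb38cbb7`):
Def 5.1 (iii) p. 115, (v) p. 117, Rmk 5.1.1 p. 118, Cor 5.2 (iii) p. 119.

PROOF-ONLY file (no `def` / `instance` / `structure` / notation; witnesses live inside the proofs).

`TPairsCor52Conditional.lean` (abc-iut-f-107) discharges FACT-LIST rows **F-0189** `ReferencePairIsoUnique` and **F-0191**
`TPairHomDeterminedByTheaterHom` CONDITIONALLY (`TPairVocabulary.referencePairIsoUnique_of_rigid`,
`TPairVocabulary.tPairHomDeterminedByTheaterHom_of_rigid`) from four laws (L) (ρ) (X) (K).  Law (X) there reads: for ALL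
Aut-holomorphic orbispaces `X Y` and ALL `i i' : AutHolOrbispace.Iso X Y`, δ-compatibility of the `π₁^∧`-components
`i.pi1Iso`, `i'.pi1Iso` (up to inner automorphism, against the same `δ`'s) forces `i.fieldIso = i'.fieldIso`.  But the cell's
`AutHolOrbispace.Iso` (`GaloisTheaters.lean`, STUB G1/T2 of record) carries the field isomorphism `A_X ≅ A_Y` as a FREE
component, unrelated to the homeomorphism and to `pi1Iso`.  Hence:

* `not_archRigidityLaw` — **(X) is false in every universe**: one point, `A_X := ℂ`, `π₁^∧ := 1`, `i := id`,
  `i' := (id, complex conjugation, id)`.  CONSEQUENCE (bookkeeping, not mathematics): the two `_of_rigid` closers have an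
  unsatisfiable hypothesis — as kernel witnesses for F-0189 / F-0191 they are VACUOUS (`archRigidityLaw_elim`).
  (`tPairIsoCanonical_of_descent`, F-0192, in the same file does not use (X) and is unaffected.)
* `not_archKappaRigidityLaw` — adding print's κ-compatibility to a law of the SAME universal shape does not help: with
  `k := ℚ ↪ ℂ`, conjugation fixes `κ(k)`.  Any archimedean rigidity law quantified over all `AutHolOrbispace.Iso` is
  refutable; the input Rmk 5.1.1 actually names ("for archimedean elements, this follows by considering the topology
  induced on `k_NF(Π)` by `A_{X_v}` via `κ_v`", p. 118) is a property of the THEATERS' data `(X_v, κ_v)`.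
* `TPairVocabulary.referencePairIsoUnique_of_kappaRigid` (F-0189) and
  `TPairVocabulary.tPairHomDeterminedByTheaterHom_of_kappaRigid` (F-0191) — the conditional closers RE-PROVED with (X)
  replaced by the theater-level law **(Xκ)**: for theaters `V⊚₁, V⊚₂`, a field identification `e : k_NF(Π₁) ≅ k_NF(Π₂)` and
  archimedean `v, w`, two isomorphisms `(X₁)_v ≅ (X₂)_w` that are BOTH `κ`-compatible through `e` induce the same `A`-isomorphism
  — i.e. `A_{X_v} ≅ A_{X_w}` is pinned by `κ_v(k_NF(Π))`.  The proofs now USE clause (c)'s κ-compatibility of Def 5.1 (v)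
  (which the `_of_rigid` proofs discarded); laws (L) (ρ) (K) are unchanged and quoted from `TPairsCor52Conditional`.
  HONEST LABEL on (Xκ): an assumption on `R` and its theaters, satisfiable (vacuous at contexts without archimedean elements,
  true wherever the `A_{X_v}` are rigid over `κ_v(k_NF)`); print obtains it from CONTINUITY + density of `κ_v(k_NF(Π)) ⊆ A_{X_v} ≅ ℂ`,
  and the typed clause (c) of Def 5.1 (v) / `GlobalTPair.Hom.φarc_kummer` does not record continuity of `fieldIso` (the
  theater-level clauses do, after the G1 repair) — so at a `ℂ`-valued context (Xκ) idealises "every automorphism of `A_{X_v}`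
  over `κ_v(k_NF)` is trivial"; the print-faithful repair is the pending T2 merge of `AutHolOrbispace.Iso`.  Recorded, not hidden.

Refereed pre-IUT anabelian geometry; bookkeeping about the cell's own interface records; nothing of [AbsTopIII] is asserted
or denied; refuted-as-typed ≠ refuted-in-print; nothing here bears on the disputed [IUTchIII] Cor. 3.12; a FACT row is an
assumption label, not an endorsement; typed ≠ proved.
-/

namespace Literature.AnabelianGeometry.AbsoluteAnabelian

open CategoryTheory Topology

universe u

/-! ### A field automorphism the stub cannot see: complex conjugation on `A_X := ℂ` -/

/-- In every universe there is a ring automorphism of (a lift of) `ℂ` different from the identity and fixing the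
rationals: complex conjugation.  (Witness material for the two refutations below.)
[cite: MochizukiAbsTopIII2015, Rmk 5.1.1 p. 118] -/
private theorem exists_ringAut_ulift_complex_ne_refl :
    ∃ τ : ULift.{u} ℂ ≃+* ULift.{u} ℂ, τ ≠ RingEquiv.refl _ ∧
      ∀ q : ℚ, τ (ULift.up (q : ℂ)) = ULift.up (q : ℂ) := by
  refine ⟨ULift.ringEquiv.trans ((starRingAut : ℂ ≃+* ℂ).trans ULift.ringEquiv.symm), fun h => ?_, fun q => ?_⟩
  · have hI := congrArg (fun τ : ULift.{u} ℂ ≃+* ULift.{u} ℂ => (τ (ULift.up Complex.I)).down) h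
    have hI' : star Complex.I = Complex.I := hI
    rw [Complex.star_def, Complex.conj_I] at hI'
    have him := congrArg Complex.im hI'
    simp only [Complex.neg_im, Complex.I_im] at him
    norm_num at him
  · change ULift.up (star ((q : ℂ))) = ULift.up (q : ℂ)
    rw [← starRingAut_apply, map_ratCast]

/-! ### (X) is refutable -/

/-- **The archimedean rigidity law (X) of `referencePairIsoUnique_of_rigid` / `tPairHomDeterminedByTheaterHom_of_rigid` is
FALSE (in every universe).**  (X) asks that for ALL `X Y : AutHolOrbispace` and ALL `i i' : AutHolOrbispace.Iso X Y`,
δ-compatibility of `i.pi1Iso`, `i'.pi1Iso` alone force `i.fieldIso = i'.fieldIso`; since the stub `AutHolOrbispace.Iso`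
records `fieldIso : A_X ≃+* A_Y` as a free component, the one-point orbispace with `A_X := ℂ`, `π₁^∧ := 1`, `i := id` and
`i' := (id, conj, id)` refutes it (`δ₁ = δ₂ = id`, `e = id`, inner-compatibility with `c = 1`).  Refuted-as-typed: print's
Rmk 5.1.1 determines `ψ_v` through `κ_v` and the topology of `A_{X_v}`, not through `δ` alone.
[cite: MochizukiAbsTopIII2015, Rmk 5.1.1 p. 118] -/
theorem not_archRigidityLaw :
    ¬ (∀ {X Y : AutHolOrbispace.{u}} {Δ₁ Δ₂ : Type u} [Group Δ₁] [TopologicalSpace Δ₁]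
        [Group Δ₂] [TopologicalSpace Δ₂] (δ₁ : Δ₁ ≃ₜ* X.pi1Hat) (δ₂ : Δ₂ ≃ₜ* Y.pi1Hat) (e : Δ₁ → Δ₂),
        Function.Bijective e → ∀ i i' : AutHolOrbispace.Iso X Y,
        InnerCompatible (fun a => i.pi1Iso (δ₁ a)) δ₂ e → InnerCompatible (fun a => i'.pi1Iso (δ₁ a)) δ₂ e →
        i.fieldIso = i'.fieldIso) := by
  intro hX
  obtain ⟨τ, hτ, -⟩ := exists_ringAut_ulift_complex_ne_refl.{u}
  let X : AutHolOrbispace.{u} :=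
    { carrier := PUnit.{u + 1}, fieldA := ULift.{u} ℂ, pi1Hat := ProfiniteGrp.of PUnit.{u + 1} }
  let i : AutHolOrbispace.Iso X X := ⟨Homeomorph.refl _, RingEquiv.refl _, ContinuousMulEquiv.refl _⟩
  let i' : AutHolOrbispace.Iso X X := ⟨Homeomorph.refl _, τ, ContinuousMulEquiv.refl _⟩
  have hc : InnerCompatible (fun a => i.pi1Iso (ContinuousMulEquiv.refl X.pi1Hat a))
      (ContinuousMulEquiv.refl X.pi1Hat) id :=
    ⟨1, fun a => by simp only [one_mul, inv_one, mul_one]; rfl⟩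
  have hc' : InnerCompatible (fun a => i'.pi1Iso (ContinuousMulEquiv.refl X.pi1Hat a))
      (ContinuousMulEquiv.refl X.pi1Hat) id :=
    ⟨1, fun a => by simp only [one_mul, inv_one, mul_one]; rfl⟩
  have h : i.fieldIso = i'.fieldIso :=
    hX (ContinuousMulEquiv.refl X.pi1Hat) (ContinuousMulEquiv.refl X.pi1Hat) id Function.bijective_id i i' hc hc'
  exact hτ h.symm

/-- **Bookkeeping consequence**: the hypothesis list of the `_of_rigid` closers is unsatisfiable — from law (X) alone ANY
proposition follows; as kernel witnesses for F-0189 / F-0191 those closers are vacuous (the non-vacuous replacements are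
`referencePairIsoUnique_of_kappaRigid` / `tPairHomDeterminedByTheaterHom_of_kappaRigid` below).
[cite: MochizukiAbsTopIII2015, Cor 5.2 (iii) p. 119] -/
theorem archRigidityLaw_elim {P : Prop}
    (hX : ∀ {X Y : AutHolOrbispace.{u}} {Δ₁ Δ₂ : Type u} [Group Δ₁] [TopologicalSpace Δ₁]
        [Group Δ₂] [TopologicalSpace Δ₂] (δ₁ : Δ₁ ≃ₜ* X.pi1Hat) (δ₂ : Δ₂ ≃ₜ* Y.pi1Hat) (e : Δ₁ → Δ₂),
        Function.Bijective e → ∀ i i' : AutHolOrbispace.Iso X Y,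
        InnerCompatible (fun a => i.pi1Iso (δ₁ a)) δ₂ e → InnerCompatible (fun a => i'.pi1Iso (δ₁ a)) δ₂ e →
        i.fieldIso = i'.fieldIso) : P :=
  (not_archRigidityLaw.{u} hX).elim

/-- **Adding κ-compatibility to a UNIVERSALLY quantified law does not rescue it**: "for all `X Y`, all subfields
`κ_X : k ↪ A_X`, `κ_Y : k ↪ A_Y` and all `i i' : X ≅ Y`, if both `i`, `i'` are κ-compatible then `i.fieldIso = i'.fieldIso`"
is false too — complex conjugation fixes `κ(ℚ) ⊆ ℂ`.  So archimedean rigidity must be an assumption on the theaters'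
data `(X_v, κ_v)` (law (Xκ) below), exactly where print's Rmk 5.1.1 puts it.
[cite: MochizukiAbsTopIII2015, Rmk 5.1.1 p. 118] -/
theorem not_archKappaRigidityLaw :
    ¬ (∀ {X Y : AutHolOrbispace.{u}} {k : Type u} [Field k] (κX : k →+* X.fieldA) (κY : k →+* Y.fieldA)
        (i i' : AutHolOrbispace.Iso X Y),
        (∀ x, κY x = i.fieldIso (κX x)) → (∀ x, κY x = i'.fieldIso (κX x)) → i.fieldIso = i'.fieldIso) := by
  intro hX
  obtain ⟨τ, hτ, hτq⟩ := exists_ringAut_ulift_complex_ne_refl.{u}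
  let X : AutHolOrbispace.{u} :=
    { carrier := PUnit.{u + 1}, fieldA := ULift.{u} ℂ, pi1Hat := ProfiniteGrp.of PUnit.{u + 1} }
  let i : AutHolOrbispace.Iso X X := ⟨Homeomorph.refl _, RingEquiv.refl _, ContinuousMulEquiv.refl _⟩
  let i' : AutHolOrbispace.Iso X X := ⟨Homeomorph.refl _, τ, ContinuousMulEquiv.refl _⟩
  -- `κ : ℚ ↪ ℂ`, lifted to universe `u`
  let κ : ULift.{u} ℚ →+* X.fieldA :=
    (ULift.ringEquiv.symm : ℂ ≃+* ULift.{u} ℂ).toRingHom.comp ((Rat.castHom ℂ).comp ULift.ringEquiv.toRingHom)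
  have hκ : ∀ x : ULift.{u} ℚ, κ x = ULift.up ((x.down : ℚ) : ℂ) := fun x => rfl
  have h : i.fieldIso = i'.fieldIso :=
    hX κ κ i i' (fun _ => rfl) (fun x => by
      change κ x = τ (κ x)
      rw [hκ, hτq])
  exact hτ h.symm

/-! ### Non-vacuous conditional closers: (X) replaced by the theater-level law (Xκ) -/

section

variable {R : GlobalAnabelianContext.{u}} {T : TKind} (W : TPairVocabulary R T)

/-- **Cor 5.2 (iii), first sentence (F-0189 `ReferencePairIsoUnique`), conditional closer with a SATISFIABLE archimedean
law.**  For every context `R` and vocabulary `W`: `ReferencePairIsoUnique W` follows from (L) Prop 3.2 (iv) (an automorphism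
of an MLF-Galois `T`-pair trivial on the Galois group is trivial), (ρ) joint monicity of the restriction morphisms
`{ρ_v}_{v ∈ V̄^non}`, **(Xκ)** — for theaters `V⊚₁, V⊚₂` of `R`, `e : k_NF(Π₁) ≅ k_NF(Π₂)` and archimedean `v, w`, two
isomorphisms `(X₁)_v ≅ (X₂)_w` both κ-compatible through `e` induce the same isomorphism `A_{(X₁)_v} ≅ A_{(X₂)_w}` (Rmk 5.1.1:
`ψ_v` is pinned "by considering the topology induced on `k_NF(Π)` by `A_{X_v}` via `κ_v`"; an assumption on `R` and its
theaters — see the module docstring for its status at a `ℂ`-valued context) — and (K) Def 4.1: Kummer transport depends on the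
orbispace isomorphism only through the induced field isomorphism and pins `ψ`.  Route: `ψ_v` (`v` nonarchimedean) by (L)
on `ψ_v⁻¹ ∘ ψ'_v`; `ψ⊚` by (ρ) and condition (d); `ψ_v` (`v` archimedean) by (Xκ) applied to the κ-clauses of condition (c)
(relative to the canonical theater `V⊚(Π)` and `e = id`), then (K).  The laws are hypotheses; the row stays an assumption at
the genuine `(R, W)`. [cite: MochizukiAbsTopIII2015, Cor 5.2 (iii) p. 119] -/
theorem TPairVocabulary.referencePairIsoUnique_of_kappaRigid (hT : T ≠ .TLG)
    (hL : ∀ {D : ProfiniteGrp.{u}} {M : W.LocObj} (act : D →* Aut M), W.IsMLFGaloisPair act →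
      ∀ α : M ≅ M, (∀ g, (act g).hom ≫ α.hom = α.hom ≫ (act g).hom) → α = Iso.refl M)
    (hρ : ∀ (P : GlobalTPair W) {A : W.GlobObj} (f g : A ⟶ P.M),
      (∀ w : P.theater.V.non, f ≫ P.ρnon w = g ≫ P.ρnon w) → f = g)
    (hX : ∀ (T₁ T₂ : GlobalGaloisTheater R) (e : R.kNF T₁.ext ≃+* R.kNF T₂.ext) (v : T₁.V.arc) (w : T₂.V.arc)
      (i i' : AutHolOrbispace.Iso (T₁.X v) (T₂.X w)),
      (∀ x, T₂.κ w (e x) = i.fieldIso (T₁.κ v x)) → (∀ x, T₂.κ w (e x) = i'.fieldIso (T₁.κ v x)) →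
      i.fieldIso = i'.fieldIso)
    (hK : ∀ {X Y : AutHolOrbispace.{u}} {M N : W.LocObj} (i i' : AutHolOrbispace.Iso X Y) (ψ ψ' : M ≅ N)
      (k : W.KummerStr X M), i.fieldIso = i'.fieldIso →
      W.kummerTransport i ψ k = W.kummerTransport i' ψ' k → W.IsAutHolPair (W.kummerTransport i ψ k) → ψ = ψ') :
    ReferencePairIsoUnique W hT := by
  intro P ψV hψV hnon harc ψ ψ' ψnon ψnon' ψarc ψarc' href href'
  obtain ⟨ha, hb, hc, hd, hd'⟩ := href
  obtain ⟨ha', hb', hc', he, he'⟩ := href'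
  have hdec : ∀ v : (R.proVal P.theater.ext).carrier,
      (R.proVal P.theater.ext).decomp v = P.theater.V.decomp (ψV v) := fun v => by
    ext g
    simp only [GaloisProSet.decomp, MulAction.mem_stabilizer_iff]
    rw [← hψV.1, ψV.injective.eq_iff]
  -- (b) + (L): the nonarchimedean reference isomorphisms agree
  have h1 : ψnon = ψnon' := by
    funext v
    have hβ := hL (P.actNon ⟨ψV v, hnon v⟩) (P.isMLF _) ((ψnon v).symm ≪≫ ψnon' v) (fun g => ?_)
    · have h := congrArg Iso.hom hβ
      simp only [Iso.trans_hom, Iso.symm_hom, Iso.refl_hom] at h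
      ext
      simpa using ((Iso.inv_comp_eq _).mp h).symm
    · obtain ⟨g, hg'⟩ := g
      have hg : g ∈ (R.proVal P.theater.ext).decomp (v : (R.proVal P.theater.ext).carrier) := by
        rw [hdec]; exact hg'
      simp only [Iso.trans_hom, Iso.symm_hom]
      have e1 : (P.actNon ⟨ψV v, hnon v⟩ ⟨g, hg'⟩).hom ≫ (ψnon v).inv =
          (ψnon v).inv ≫ (W.locAct _ v ⟨g, hg⟩).hom := by
        rw [Iso.comp_inv_eq, Category.assoc, Iso.eq_inv_comp]; exact (hb v g hg hg').symm
      rw [← Category.assoc, e1, Category.assoc, hb' v g hg hg', Category.assoc]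
  -- (d) + (ρ): the global reference isomorphisms agree
  have h2 : ψ = ψ' := by
    ext
    apply hρ P
    rintro ⟨w, hw⟩
    obtain ⟨v, hv, rfl⟩ : w ∈ ψV '' (R.proVal P.theater.ext).non := by rw [hψV.2.2.1]; exact hw
    have e1 := hd ⟨v, hv⟩
    have e2 := he ⟨v, hv⟩
    rw [← h1] at e2
    exact e1.symm.trans e2
  -- (c) + (Xκ) + (K): the archimedean reference isomorphisms agree — via the κ-clauses of (c)
  have h3 : ψarc = ψarc' := by
    funext v
    obtain ⟨i, -, hκ, hk⟩ := hc v
    obtain ⟨i', -, hκ', hk'⟩ := hc' v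
    have hf : i.fieldIso = i'.fieldIso :=
      hX (R.theater P.theater.ext P.theater.isAdmissible) P.theater (RingEquiv.refl _) v ⟨ψV v, harc v⟩ i i'
        (fun x => hκ x) (fun x => hκ' x)
    exact hK i i' (ψarc v) (ψarc' v) (W.locKummer _ v) hf (hk.trans hk'.symm) (by rw [hk]; exact P.isAutHol _)
  exact ⟨h2, h1, h3⟩

/-- **Cor 5.2 (iii), second sentence (F-0191 `TPairHomDeterminedByTheaterHom`), conditional closer with a SATISFIABLE
archimedean law**: in a morphism of global `T`-pairs, `φ⊚` and `{φ_v}` are determined by `φ_{V⊚}` — from (L), (ρ), the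
theater-level law **(Xκ)** (two κ-compatible isomorphisms `(X₁)_{v₁} ≅ (X₂)_{v₂}` through `k_NF(φ_Π)` induce the same
`A`-isomorphism) and (K).  Route: `φ_{v₁}` (nonarchimedean) by (L) on `φ_{v₁} ∘ φ'_{v₁}⁻¹`; `φ⊚` by (ρ), condition (d) and
`φ_V(V̄^non₁) = V̄^non₂`; `φ_{v₁}` (archimedean) by (Xκ) on the κ-clauses of condition (c) with `e := k_NF(φ_Π)`, then (K).
The laws are hypotheses; the row stays an assumption at the genuine `(R, W)`.
[cite: MochizukiAbsTopIII2015, Cor 5.2 (iii) p. 119] -/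
theorem TPairVocabulary.tPairHomDeterminedByTheaterHom_of_kappaRigid (hT : T ≠ .TLG)
    (hL : ∀ {D : ProfiniteGrp.{u}} {M : W.LocObj} (act : D →* Aut M), W.IsMLFGaloisPair act →
      ∀ α : M ≅ M, (∀ g, (act g).hom ≫ α.hom = α.hom ≫ (act g).hom) → α = Iso.refl M)
    (hρ : ∀ (P : GlobalTPair W) {A : W.GlobObj} (f g : A ⟶ P.M),
      (∀ w : P.theater.V.non, f ≫ P.ρnon w = g ≫ P.ρnon w) → f = g)
    (hX : ∀ (T₁ T₂ : GlobalGaloisTheater R) (e : R.kNF T₁.ext ≃+* R.kNF T₂.ext) (v : T₁.V.arc) (w : T₂.V.arc)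
      (i i' : AutHolOrbispace.Iso (T₁.X v) (T₂.X w)),
      (∀ x, T₂.κ w (e x) = i.fieldIso (T₁.κ v x)) → (∀ x, T₂.κ w (e x) = i'.fieldIso (T₁.κ v x)) →
      i.fieldIso = i'.fieldIso)
    (hK : ∀ {X Y : AutHolOrbispace.{u}} {M N : W.LocObj} (i i' : AutHolOrbispace.Iso X Y) (ψ ψ' : M ≅ N)
      (k : W.KummerStr X M), i.fieldIso = i'.fieldIso →
      W.kummerTransport i ψ k = W.kummerTransport i' ψ' k → W.IsAutHolPair (W.kummerTransport i ψ k) → ψ = ψ') :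
    TPairHomDeterminedByTheaterHom W hT := by
  intro P₁ P₂ φ φ' hV
  obtain ⟨φV, φM, hMe, nm, am, φn, hne, φa, hak, hρn, hρa⟩ := φ
  obtain ⟨φV', φM', hMe', nm', am', φn', hne', φa', hak', hρn', hρa'⟩ := φ'
  cases hV
  -- (b) + (L): the nonarchimedean components agree
  have h1 : φn = φn' := by
    funext v
    have hβ := hL (P₁.actNon v) (P₁.isMLF v) (φn v ≪≫ (φn' v).symm) (fun g => ?_)
    · have h := congrArg Iso.hom hβ
      simp only [Iso.trans_hom, Iso.symm_hom, Iso.refl_hom] at h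
      ext
      simpa using (Iso.comp_inv_eq _).mp h
    · obtain ⟨g, hg⟩ := g
      have hg₂ : φV.φgrp.arith g ∈ P₂.theater.V.decomp (φV.φV v) := φV.map_decomp_le v ⟨g, hg, rfl⟩
      simp only [Iso.trans_hom, Iso.symm_hom]
      have e1 : (P₂.actNon ⟨φV.φV v, nm' v⟩ ⟨φV.φgrp.arith g, hg₂⟩).hom ≫ (φn' v).inv =
          (φn' v).inv ≫ (P₁.actNon v ⟨g, hg⟩).hom := by
        rw [Iso.comp_inv_eq, Category.assoc, Iso.eq_inv_comp]; exact (hne' v g hg hg₂).symm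
      rw [← Category.assoc, hne v g hg hg₂, Category.assoc, e1, Category.assoc]
  -- (d) + (ρ): the global components agree
  have h2 : φM = φM' := by
    ext
    apply hρ P₂
    rintro ⟨w, hw⟩
    obtain ⟨v, hv, rfl⟩ : w ∈ φV.φV '' P₁.theater.V.non := by rw [φV.image_non]; exact hw
    have e1 := hρn ⟨v, hv⟩
    have e2 := hρn' ⟨v, hv⟩
    rw [← h1] at e2
    exact e1.symm.trans e2
  -- (c) + (Xκ) + (K): the archimedean components agree — via the κ-clauses of (c)
  have h3 : φa = φa' := by
    funext v
    obtain ⟨i, -, hκ, hk⟩ := hak v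
    obtain ⟨i', -, hκ', hk'⟩ := hak' v
    have hf : i.fieldIso = i'.fieldIso :=
      hX P₁.theater P₂.theater (R.mapKNF φV.φgrp φV.isEAHom) v ⟨φV.φV v, am v⟩ i i' hκ hκ'
    exact hK i i' (φa v) (φa' v) (P₁.kummer v) hf (hk.trans hk'.symm) (by rw [hk]; exact P₂.isAutHol _)
  subst h1 h2 h3
  exact ⟨rfl, HEq.rfl, HEq.rfl⟩

end

end Literature.AnabelianGeometry.AbsoluteAnabelian
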